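import Summits.Ventures.GridStability.Models.NE39SP
import Summits.Ventures.GridStability.Lyapunov.StructurePreservingPolytopeRoa
import Summits.Ventures.GridStability.Lyapunov.StructurePreservingPolytopeLevel
import HarnessLib

/-!
# GridStability/Bench/NE39SPPolytopeRoa — the 49-node STRUCTURE-PRESERVING New England instance on
# Vu–Turitsyn's polytope: the certified synchronisation region at the RATIONAL level `c = 19`
# (solver-free; every damping vector `D > 0`) — 6.5× the window-route level `29/10` of p481288

Cell `gridfusion` (LADDER-GRIDFUSION), seat gridfusion-lyap-1 (g6); brief «SP-POLYTOPE» (lead RULING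
6i (5) «LFF-NU-SPARSE» — «a solver-free synchronisation-region THEOREM ROW at 39-bus size (G2.b
tier, THM rule L ∧ D-by-reference ∧ R1 ∧ R2)» — as repaired on INBOX 2026-08-27). INSTANCE OF
RECORD BY NAME: model-2's `Models/NE39SP.lean` (`NE39SP.params D`: data model-4
`bench/data/NE39/sp49/sp49.json` fddec35dcf838149 = [cite: Padiyar2013, App. D Tables D.1–D.4], column
LF couplings `wtLFQ`, half-angle tangents `tLFQ`, `δ₀ = halfAngle t`, `P⁰ := f(δ₀)`; the damping /
load-frequency vector `D` is a PARAMETER — no printed values exist). NO NEW DATA LITERAL here: the only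
numerals of this file are the level `19` and Mathlib's `π < 3.141593` inside `ratGap`. THEOREM OF
RECORD: this seat's `Lyapunov.StructurePreserving.vtSublevel_subset_regionOfAttraction`
(`StructurePreservingPolytopeRoa.lean`) — the Bergen–Hill energy route on the polytope
`𝒫 = {|(δᵢ − δⱼ) + (δ₀ᵢ − δ₀ⱼ)| < π on coupled pairs}` [cite: VuTuritsyn2016, §IV] with the per-edge
closed-form level `c < bᵢⱼ·vtGap(δ₀ᵢ − δ₀ⱼ)` [cite: VuTuritsyn2016, Appendix 9.3].

THREE COLUMNS. CERTIFIED (kernel, here): `edgeChecks` — for each of the 56 listed edges `e`, over `ℚ`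
by ONE `decide`: `t_src·t_tgt > −1`, `0 ≤ ratGap q_e` and `19 < wt_e · ratGap q_e`
(`q_e = (t_src − t_tgt)/(1 + t_src t_tgt)`; `ratGap q = 2(1 − q²)/(1 + q²) − (3.141593 −
4|q|/(1 + q²))·2|q|/(1 + q²) ≤ vtGap(2·arctan t_src − 2·arctan t_tgt)`,
`StructurePreservingPolytopeLevel.ratGap_le_vtGap`); hence `level_lt_edgeGap`: `19 < bᵢⱼ·vtGap(δ₀ᵢ −
δ₀ⱼ)` on EVERY coupled pair (binding edge bus 9–G9: `wt·ratGap = 19.141…`; exact per-edge minimum of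
`b·vtGap` ≈ 19.32); and the two sentences below. Comparison (same data, same Lyapunov function, same
leaf): the window route of record certifies `V ≤ 29/10` on `{|δᵢ − δⱼ| < π/2}` (p481288,
`Bench/NE39SPEnergyRoa.lean`); this file certifies `V ≤ 19` on the larger set `𝒫` — ratio of LEVELS
`190/29 ≈ 6.55` (a ratio of levels, not of volumes). MODELLED (model MV-3 with the instance tokens of
model-2's file: «MV-3 + lossless + MV-P + D(∀) + ω_s declared + V-frozen(LF) + |E|′(h12)»;
structure-preserving classical machines, constant voltage magnitudes, first-order frequency-dependent
loads with UNPRINTED coefficients `Dᵢ > 0` — every statement holds for ALL such `D`, the level does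
not depend on `D`). VALIDATED (not here): any juxtaposition with Padiyar Table 4.2/4.3 critical energies
(model-4 `validated-Padiyar2013.json`; different load model, not like-for-like). No SDP, no Gram
matrix, no interval arithmetic; no sentence of this file says that the New England system or any grid
is stable. No definition except the bookkeeping abbreviation `hqQ`; no named fact; standard axioms.
-/

noncomputable section

open Set Filter Topology Real
open Summit.Ventures.GridStability.Models
open Summit.Ventures.GridStability.Models.StructurePreserving
open Summit.Ventures.GridStability.Models.NE39SP
open Summit.Ventures.GridStability.Lyapunov.StructurePreserving
open Literature.MathematicalPhysics.PowerSystems.ClassicalModel.LosslessSystem (vtGap)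

namespace Summit.Ventures.GridStability.Bench.NE39SP

/-- The half-angle-tangent quotient of listed edge `e` over `ℚ` (bookkeeping for the `decide`):
`q_e = (t_src − t_tgt)/(1 + t_src·t_tgt)` on model-2's literals `tLFQ`, `srcV`, `tgtV`. -/
def hqQ (e : Fin 56) : ℚ :=
  (NE39SP.tLFQ (NE39SP.srcV e) - NE39SP.tLFQ (NE39SP.tgtV e))
    / (1 + NE39SP.tLFQ (NE39SP.srcV e) * NE39SP.tLFQ (NE39SP.tgtV e))

/-- **The 56 per-edge kernel checks over `ℚ` (one `decide`)**: `t_src·t_tgt > −1`, the rational gap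
bound is nonnegative, and `19 < wt_e · ratGap q_e` (column LF). Binding edge: bus 9–G9 (index 18,
`wt·ratGap = 19.141…`). CERTIFIED column. [cite: VuTuritsyn2016, Appendix 9.3] -/
theorem edgeChecks : ∀ e : Fin 56,
    (-1 : ℚ) < NE39SP.tLFQ (NE39SP.srcV e) * NE39SP.tLFQ (NE39SP.tgtV e) ∧
      0 ≤ ratGap (hqQ e) ∧ (19 : ℚ) < NE39SP.wtLFQ e * ratGap (hqQ e) := by
  decide +kernel

/-- The quotient cast to `ℝ` is `hq` of the real half-angle tangents. [folklore] -/
theorem hqQ_cast (e : Fin 56) :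
    ((hqQ e : ℚ) : ℝ) = hq (NE39SP.t (NE39SP.srcV e)) (NE39SP.t (NE39SP.tgtV e)) := by
  unfold hqQ hq NE39SP.t
  push_cast
  rfl

/-- **The certified per-edge level on EVERY coupled pair**: `19 < bᵢⱼ · vtGap(δ₀ᵢ − δ₀ⱼ)` whenever
`bᵢⱼ ≠ 0` (column LF; from `edgeChecks` through `level_of_edgeChecks` and `ratGap_le_vtGap`).
CERTIFIED column. [cite: VuTuritsyn2016, §IV (third construction) and Appendix 9.3] -/
theorem level_lt_edgeGap (D : Fin 49 → ℝ) :
    ∀ i j, (params D).b i j ≠ 0 → (19 : ℝ) < (params D).b i j * vtGap (NE39SP.δ₀ i - NE39SP.δ₀ j) := by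
  intro i j hij
  rw [params_b] at hij ⊢
  have hprod : ∀ e, (-1 : ℝ) < NE39SP.t (NE39SP.srcV e) * NE39SP.t (NE39SP.tgtV e) := fun e => by
    unfold NE39SP.t
    exact_mod_cast (edgeChecks e).1
  have hR0 : ∀ e, 0 ≤ ratGap (hq (NE39SP.t (NE39SP.srcV e)) (NE39SP.t (NE39SP.tgtV e))) := fun e => by
    rw [← hqQ_cast, ← ratGap_ratCast]
    exact_mod_cast (edgeChecks e).2.1
  have hc : ∀ e, (19 : ℝ) < NE39SP.wt e
      * ratGap (hq (NE39SP.t (NE39SP.srcV e)) (NE39SP.t (NE39SP.tgtV e))) := fun e => by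
    rw [← hqQ_cast, ← ratGap_ratCast]
    unfold NE39SP.wt
    exact_mod_cast (edgeChecks e).2.2
  exact level_of_edgeChecks NE39SP.wt_nonneg hprod hR0 hc hij

/-- The equilibrium line angles are STRICTLY below `π/2` on coupled pairs (`θ = 2·arctan τ_max < π/2`,
model-2's `window` and `theta_lt_pi_div_two`). [folklore] -/
theorem window_strict (D : Fin 49 → ℝ) :
    ∀ i j, (params D).b i j ≠ 0 → |NE39SP.δ₀ i - NE39SP.δ₀ j| < π / 2 :=
  fun i j hij => (NE39SP.window D i j hij).trans_lt NE39SP.theta_lt_pi_div_two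

/-- **«G2.b-SP NE39» on Vu–Turitsyn's polytope — the certified region (phase-space form), level
`19`.** MODEL MV-3 at the NE39-SP instance of record (column LF), for EVERY damping / load-frequency
vector `D > 0`: from every phase point `y = (δ, ω)` with every coupled line angle in the polytope
`|(δᵢ − δⱼ) + (δ₀ᵢ − δ₀ⱼ)| < π`, on the momentum leaf through the equilibrium with zero bus
pseudo-frequencies, and with energy `V(δ₀; δ, ω) ≤ 19`, a global solution of the structure-preserving
field exists, and EVERY global solution from `y` keeps the polytope, the leaf and `V ≤ 19` for all
`t ≥ 0` and tends to `(δ₀, 0)`. One call of `vtSublevel_subset_regionOfAttraction` with model-2's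
data facts (`wellFormed`, `preconnected`, `b_nonneg`, `window`, `isSyncEquilibrium`) and
`level_lt_edgeGap`. No sentence here says a grid is stable.
[cite: VuTuritsyn2016, §IV; Padiyar2013, App. D, §3.2 eq (3.2)] -/
theorem polytope_roa {D : Fin 49 → ℝ} (hD : ∀ i, 0 < D i) {y : (Fin 49 → ℝ) × (Fin 49 → ℝ)}
    (hy : y ∈ vtPolytope (params D) NE39SP.δ₀ ∩ constraintSet (params D) NE39SP.δ₀ ∧
      phaseEnergy (params D) NE39SP.δ₀ y ≤ 19) :
    (∃ X : ℝ → (Fin 49 → ℝ) × (Fin 49 → ℝ), X 0 = y ∧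
      ∀ T : ℝ, ∀ s ∈ Icc 0 T, HasDerivWithinAt X (phaseField (params D) (X s)) (Icc 0 T) s) ∧
    ∀ X : ℝ → (Fin 49 → ℝ) × (Fin 49 → ℝ), X 0 = y →
      (∀ T : ℝ, ∀ s ∈ Icc 0 T, HasDerivWithinAt X (phaseField (params D) (X s)) (Icc 0 T) s) →
      (∀ s, 0 ≤ s → X s ∈ vtPolytope (params D) NE39SP.δ₀ ∩ constraintSet (params D) NE39SP.δ₀ ∧
        phaseEnergy (params D) NE39SP.δ₀ (X s) ≤ 19) ∧ Tendsto X atTop (𝓝 (NE39SP.δ₀, 0)) :=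
  vtSublevel_subset_regionOfAttraction (wellFormed hD) (by decide) (preconnected D)
    (fun i j => by rw [params_b]; exact b_nonneg i j) (window_strict D) (isSyncEquilibrium D)
    (level_lt_edgeGap D) hy

/-- **The same in the printed second-order vocabulary** [cite: Padiyar2013, §3.2 eqs (3.3)–(3.5)]:
for EVERY `D > 0` and every solution `δ` of the structure-preserving model `params D` AS PRINTED
(model-2's `Params.IsSolution`; `ω₀ = 0` here because `P⁰ := f(δ₀)`) whose initial state has every
coupled line angle in the polytope `|(δᵢ(0) − δⱼ(0)) + (δ₀ᵢ − δ₀ⱼ)| < π`, momentum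
`L(δ(0), δ̇(0)) = L(δ₀, 0)` and energy `V(δ₀; δ(0), δ̇(0)) ≤ 19`: the polytope and `V ≤ 19` hold for
all `t ≥ 0`, every node angle converges, `δᵢ(t) → δ₀ᵢ`, and every generator frequency deviation tends
to zero, `δ̇ᵢ(t) → 0` (`i` an internal node). MODEL MV-3; no sentence here says a grid is stable.
[cite: VuTuritsyn2016, §IV; BergenHill1981] -/
theorem polytope_tendsto_of_isSolution {D : Fin 49 → ℝ} (hD : ∀ i, 0 < D i) {δ : ℝ → Fin 49 → ℝ}
    (hδ : (params D).IsSolution δ)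
    (hpol : ∀ i j, (params D).b i j ≠ 0 → |(δ 0 i - δ 0 j) + (NE39SP.δ₀ i - NE39SP.δ₀ j)| < π)
    (hL : (params D).momentum (δ 0) (fun i => deriv (fun u => δ u i) 0)
      = (params D).momentum NE39SP.δ₀ 0)
    (hV : (params D).energy NE39SP.δ₀ (δ 0) (fun i => deriv (fun u => δ u i) 0) ≤ 19) :
    (∀ t, 0 ≤ t →
        (∀ i j, (params D).b i j ≠ 0 → |(δ t i - δ t j) + (NE39SP.δ₀ i - NE39SP.δ₀ j)| < π) ∧
        (params D).energy NE39SP.δ₀ (δ t) (fun i => deriv (fun u => δ u i) t) ≤ 19) ∧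
      Tendsto δ atTop (𝓝 NE39SP.δ₀) ∧
      ∀ i ∈ (params D).gen, Tendsto (fun t => deriv (fun u => δ u i) t) atTop (𝓝 0) := by
  have hs : (params D).shifted.IsSolution δ := by
    rw [(params D).shifted_eq_self_of_P0_eq_pe NE39SP.b_symm (NE39SP.params_P0 D)]
    exact hδ
  exact tendsto_of_isSolution_vt (wellFormed hD) (by decide) (preconnected D)
    (fun i j => by rw [params_b]; exact b_nonneg i j) (window_strict D) (isSyncEquilibrium D)
    (level_lt_edgeGap D) hs hpol hL hV

/-- **The equilibrium itself is certified** (the region is a neighbourhood of `(δ₀, 0)` in the leaf):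
`(δ₀, 0)` lies in the polytope, on the leaf, with `V = 0 ≤ 19`. [folklore] -/
theorem equilibrium_mem_region (D : Fin 49 → ℝ) :
    ((NE39SP.δ₀, 0) : (Fin 49 → ℝ) × (Fin 49 → ℝ)) ∈
        vtPolytope (params D) NE39SP.δ₀ ∩ constraintSet (params D) NE39SP.δ₀ ∧
      phaseEnergy (params D) NE39SP.δ₀ ((NE39SP.δ₀, 0) : (Fin 49 → ℝ) × (Fin 49 → ℝ)) ≤ 19 :=
  equilibrium_mem_vtSublevel (params D) (window_strict D) (by norm_num)

/-- **The polytope region DOMINATES the window region of record** (APPEND 2026-08-27, lyap-1 g6):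
for every `D`, the certified set of rung «G2.b-SP NE39» (p481288: `V ≤ 29/10` on the phase-cohesive
window `|δᵢ − δⱼ| < π/2`, momentum leaf) is CONTAINED in the certified set of this file (`V ≤ 19` on
Vu–Turitsyn's polytope, same leaf): `window ⊆ polytope` (part 1's `window_subset_vtPolytope`, the
equilibrium line angles being below `π/2`) and `29/10 ≤ 19`. Same model, same Lyapunov function, same
leaf; a containment of certified SETS (not a statement about any grid). [folklore] -/
theorem window_region_subset_polytope_region (D : Fin 49 → ℝ) :
    {y : (Fin 49 → ℝ) × (Fin 49 → ℝ) |
        y ∈ (params D).window ∩ (params D).constraintSet NE39SP.δ₀ ∧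
          (params D).energy NE39SP.δ₀ y.1 y.2 ≤ 29 / 10}
      ⊆ {y | y ∈ vtPolytope (params D) NE39SP.δ₀ ∩ constraintSet (params D) NE39SP.δ₀ ∧
          phaseEnergy (params D) NE39SP.δ₀ y ≤ 19} := by
  rintro y ⟨⟨hw, hM⟩, hV⟩
  refine ⟨⟨?_, ?_⟩, ?_⟩
  · have hw' : y ∈ window (params D) := by rwa [(params D).lyapunov_window_eq]
    exact window_subset_vtPolytope (params D) (fun i j hij => (window_strict D i j hij).le) hw'
  · rwa [(params D).lyapunov_constraintSet_eq NE39SP.δ₀]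
  · rw [phaseEnergy_apply]
    linarith

end Summit.Ventures.GridStability.Bench.NE39SP

end
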